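import Literature.Algebra.EuclideanLattices.RegevQuantumPartFourier
import Literature.Algebra.EuclideanLattices.RegevSmoothingLowerBound
import Literature.Computability.QuantumComplexity.QStateL2
import Mathlib.LinearAlgebra.Matrix.Kronecker
import HarnessLib

/-!
# Regev 2009, Lemma 3.14: the ideal quantum step outputs `D_{L,1/√2}` up to `2^{-Ω(n)}`

Topic `Algebra/EuclideanLattices` (family `pqc`). Serves the decomposition of the named fact
`Literature.Computability.Cryptography.regev_lwe_to_sivp_quantum` (pqc.S19; Regev, J. ACM 56 (2009),
Thm 1.1): the quantum half of the iterative step, **Lemma 3.14** (author's version arXiv:2401.03703,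
pp. 19–20). *"… the resulting [prepared] state is exponentially close to `|ϑ₂⟩` … We now apply the
quantum Fourier transform on `ℤ_Rⁿ` … the resulting state can be equivalently written as
`∑_{x ∈ P(RL) ∩ L} ∑_{y ∈ RL} ρ(y − x)|x⟩` … by Claim 3.13 [and `λ₁(RL) ≥ 2^{3n} > 2√n`] this state
is exponentially close to `∑_{x ∈ L, ‖x‖ < √n} ρ(x)|x mod P(RL)⟩`. We now measure this state and
obtain `x mod P(RL)` for some vector `x` with `‖x‖ < √n` … we can recover `x` by using, e.g., Babai's
nearest plane algorithm. The output of the algorithm is `x`. We claim that the distribution of `x` is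
exponentially close to `D_{L,1/√2}` … the probability of obtaining any `x ∈ L`, `‖x‖ < √n` is
proportional to `ρ(x)² = ρ_{1/√2}(x)`. It remains to notice that by Lemma 2.5, all but an
exponentially small fraction of the probability distribution `D_{L,1/√2}` is on points of norm less
than `√n`."*

This file PROVES that analysis end to end, as a statement about vectors in `ℂ^{ℤ_Rⁿ}` (the register
holds the coordinates `s` of `Λ = L*/R`, `RegevPeriodicGaussianState`; `F` is the unitary QFT
`QFTZModPow.qftMatrix`; the prepared state is any unit vector `ψ` within `η` of the normalised
truncated periodic Gaussian `ϑ̂₁`; the decoder is any map `dec` returning the unique point of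
`u_t + RL` of norm `< √n` when there is one). Writing `D = D_{L,1/√2}` and `n = dim`:

* `qft_normalize_thetaTwo` — `F ϑ̂₂ = ϑ̂₂'` (from `F ϑ₂ = c ϑ₂'`, `RegevQuantumPartFourier`);
* `l2_normalize_thetaTwo_sub_le`, `…'` — `‖ϑ̂₂ − ϑ̂₁‖₂ ≤ 2·2⁻ⁿ` before and after `F` (Claim 3.13);
* `truncAmp_primal_eq_of_short`, `truncAmp_primal_eq_zero` — under `λ₁(RL) > 2√n`, `ϑ₁'(t) = ρ(x_t)`
  for the unique short `x_t ∈ u_t + RL`, else `0`;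
* `sum_normSq_normalize_thetaOne'_eq` — the ideal output law is `D` conditioned on `‖x‖ < √n`:
  `∑_{t : dec t ∈ A} |ϑ̂₁'(t)|² = ρ_{1/√2}(L ∩ A ∩ √nB) / ρ_{1/√2}(L ∩ √nB)`;
* `abs_cond_sub_le` + Banaszczyk (`gaussianMass_diff_ball_div_le`) —
  `|D(A | √nB) − D(A)| ≤ D(‖x‖ ≥ √n) ≤ 2⁻ⁿ`;
* `shortVectorsTrivial_of_successiveMinimum_le` — Regev's hypothesis `R ≥ 2^{3n}λₙ(L*)`, i.e.
  `λₙ(Λ) ≤ 2^{-3n}`, gives `λ₁(RL) > 2√n` (lower transference bound `λₙ(Λ)λ₁(Λ*) ≥ 1`);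
* **`lemma_3_14_ideal`** — for every event `A ⊆ V`:
  `|Pr_{t ∼ |Fψ|²}[dec t ∈ A] − D_{L,1/√2}(A)| ≤ 2η + 9·2⁻ⁿ`;
* `lemma_3_14_ideal_aux` — the same with an auxiliary (work/garbage/ancilla) register `Y`: `ψ` on
  `ℤ_Rⁿ × Y` within `η` of `ϑ̂₁ ⊗ g`, QFT as `F ⊗ I` (`kronecker_one_mem_unitaryGroup`), read-out of `t`;
* `lemma_3_14_ideal_of_basis` — the same from Regev's data `(L, (Lⱼ), R)`: `Λ = L*/R` is built as
  `dualOver R L b` with basis `dualOverZBasis` (`Lⱼ = e*ⱼ/R`, `primalLattice_dualOver : L` recovered,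
  `reprPt_dualOver : u_t = ∑ tⱼLⱼ`), hypotheses `x ∈ L, ‖Rx‖ < 2√n ⇒ x = 0` (which
  `eq_zero_of_norm_smul_lt` derives from the printed `R ≥ 2^{3n}λₙ(L*)`) and the decoder property
  for `∑ tⱼLⱼ + Rx`, conclusion with `D_{L,1/√2}` itself;
* `gaussianMass_smul_set`, `gaussianMass_ratio_smul` — scaling `D_{aL,as}(aA) = D_{L,s}(A)`, which gives
  the general parameter of Lemma 3.14 (`CVP_{L*,d}` oracle, output `D_{L,√n/(√2 d)}`) from the case
  `d = √n` treated here, applied to the lattice `(d/√n)L` ("by scaling").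

## References

* O. Regev, *On lattices, learning with errors, random linear codes, and cryptography*, J. ACM 56
  (2009), art. 34; author's version arXiv:2401.03703, Lemma 3.14 and its proof, Claim 3.13,
  Lemma 2.5 [Regev2009].
* W. Banaszczyk, Math. Ann. 296 (1993), Lemma 1.5(i) [Banaszczyk1993].
-/

noncomputable section

open Module Metric Complex Matrix
open scoped Real InnerProductSpace ENNReal Kronecker

namespace Literature.Algebra.EuclideanLattices

namespace Regev2009

open Literature.Computability.QuantumComplexity Literature.Computability.QuantumComplexity.QState

variable {V : Type*} [NormedAddCommGroup V] [InnerProductSpace ℝ V] [FiniteDimensional ℝ V]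
  [MeasurableSpace V] [BorelSpace V]
variable {ι : Type*} [Fintype ι] [DecidableEq ι]
variable (Λ : Submodule ℤ V) [DiscreteTopology Λ] [IsZLattice ℝ Λ] (e : Basis ι ℤ Λ) (R : ℕ) [NeZero R]

/-! ### The four state vectors -/

/-- `ϑ₂(s) = ρ(x_s + RΛ)` as a complex vector. [cite: Regev2009, Claim 3.13, Lemma 3.14 (eq. (12))] -/
def thetaTwo : (ι → ZMod R) → ℂ := fun s => ((periodicAmp Λ e R s : ℝ) : ℂ)

/-- `ϑ₁(s)` (truncated) as a complex vector: the state prepared by the first step, ideally.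
[cite: Regev2009, Claim 3.13, Lemma 3.14] -/
def thetaOne : (ι → ZMod R) → ℂ := fun s => ((truncAmp Λ e R s : ℝ) : ℂ)

/-- `ϑ₂'(t) = ρ(u_t + RL)`, the full periodic Gaussian after the QFT. [cite: Regev2009, Lemma 3.14] -/
def thetaTwo' : (ι → ZMod R) → ℂ := fun t => ((periodicAmp (primalLattice Λ e R) (primalZBasis Λ e R) R t : ℝ) : ℂ)

/-- `ϑ₁'(t)`, its truncation (the ideal state that is measured). [cite: Regev2009, Lemma 3.14] -/
def thetaOne' : (ι → ZMod R) → ℂ := fun t => ((truncAmp (primalLattice Λ e R) (primalZBasis Λ e R) R t : ℝ) : ℂ)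

/-! ### Generic facts about a pair `(Λ, e)` (applied to both sides of the QFT) -/

section Generic

variable {Λ R}
variable (M : Submodule ℤ V) [DiscreteTopology M] [IsZLattice ℝ M] (b : Basis ι ℤ M)

omit [MeasurableSpace V] [BorelSpace V] [DecidableEq ι] [IsZLattice ℝ M] in
/-- The amplitude `ϑ₂(s)` is positive (the term `y = 0` alone is `ρ(x_s) > 0`). [folklore] -/
theorem periodicAmp_pos (s : ι → ZMod R) : 0 < periodicAmp M b R s := by
  unfold periodicAmp
  have hsum : Summable fun y : M => gaussianFunction 1 (latticePt M b (fun i => ((s i).val : ℤ)) + (R : ℝ) • (y : V)) := by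
    have h := summable_gaussianFunction_sub (scaledLattice M R) one_ne_zero (-latticePt M b fun i => ((s i).val : ℤ))
    rw [← (scaledEquiv M R).summable_iff] at h
    refine h.congr fun y => ?_
    simp only [Function.comp_apply, coe_scaledEquiv, sub_neg_eq_add, add_comm]
  exact hsum.tsum_pos (fun _ => (gaussianFunction_pos _ _).le) 0 (gaussianFunction_pos _ _)

omit [MeasurableSpace V] [BorelSpace V] in
/-- **`‖ϑ₂ − ϑ₁‖₂ ≤ 2⁻ⁿ‖ϑ₂‖₂`** for the complex coordinate vectors (Claim 3.13 in coordinates).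
[cite: Regev2009, Claim 3.13] -/
theorem l2_thetaTwo_sub_thetaOne_le :
    l2 ((fun s => ((periodicAmp M b R s : ℝ) : ℂ)) - fun s => ((truncAmp M b R s : ℝ) : ℂ)) ≤
      (2⁻¹ : ℝ) ^ finrank ℝ V * l2 (fun s => ((periodicAmp M b R s : ℝ) : ℂ)) := by
  have h := claim_3_13_coords M b R
  have hsq1 : l2 ((fun s => ((periodicAmp M b R s : ℝ) : ℂ)) - fun s => ((truncAmp M b R s : ℝ) : ℂ)) ^ 2 =
      ∑ s : ι → ZMod R, tailAmp M b R s ^ 2 := by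
    rw [l2_sq]
    refine Finset.sum_congr rfl fun s _ => ?_
    rw [Pi.sub_apply, ← Complex.ofReal_sub, Complex.norm_real, Real.norm_eq_abs, sq_abs,
      periodicAmp_eq_truncAmp_add_tailAmp, add_sub_cancel_left]
  have hsq2 : l2 (fun s => ((periodicAmp M b R s : ℝ) : ℂ)) ^ 2 = ∑ s : ι → ZMod R, periodicAmp M b R s ^ 2 := by
    rw [l2_sq]
    refine Finset.sum_congr rfl fun s _ => ?_
    rw [Complex.norm_real, Real.norm_eq_abs, sq_abs]
  rw [← hsq1, ← hsq2, show (2⁻¹ : ℝ) ^ (2 * finrank ℝ V) = ((2⁻¹ : ℝ) ^ finrank ℝ V) ^ 2 by rw [← pow_mul, mul_comm],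
    ← mul_pow] at h
  exact (pow_le_pow_iff_left₀ (l2_nonneg _) (mul_nonneg (by positivity) (l2_nonneg _)) two_ne_zero).1 h

omit [MeasurableSpace V] [BorelSpace V] in
/-- **`‖ϑ̂₂ − ϑ̂₁‖₂ ≤ 2·2⁻ⁿ`** for the normalised states. [cite: Regev2009, Claim 3.13 ("the ℓ₂ distance between the normalized quantum states")] -/
theorem l2_normalize_thetaTwo_sub_normalize_thetaOne_le :
    l2 (normalize (fun s => ((periodicAmp M b R s : ℝ) : ℂ)) - normalize fun s => ((truncAmp M b R s : ℝ) : ℂ)) ≤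
      2 * (2⁻¹ : ℝ) ^ finrank ℝ V := by
  refine l2_normalize_sub_normalize_le (fun h => ?_) (l2_thetaTwo_sub_thetaOne_le M b)
  have h0 := congrFun h 0
  simp only [Pi.zero_apply, Complex.ofReal_eq_zero] at h0
  exact (periodicAmp_pos M b 0).ne' h0

end Generic

/-! ### The QFT step on normalised states -/

/-- **`F ϑ̂₂ = ϑ̂₂'`**: the unitary QFT maps the normalised periodic Gaussian state of `RΛ ≤ Λ` to the
normalised periodic Gaussian state of `RL ≤ L` (from `F ϑ₂ = c ϑ₂'`, `c > 0`, and `‖F·‖₂ = ‖·‖₂`).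
[cite: Regev2009, Lemma 3.14 (proof, p. 20)] -/
theorem qft_normalize_thetaTwo :
    QFTZMod.qftMatrix ι R *ᵥ normalize (thetaTwo Λ e R) = normalize (thetaTwo' Λ e R) := by
  have hF := qft_periodicAmp_vec Λ e R
  have hU := QFTZMod.qftMatrix_mem_unitaryGroup (ι := ι) R
  change QFTZMod.qftMatrix ι R *ᵥ ((l2 (thetaTwo Λ e R))⁻¹ • thetaTwo Λ e R) = _
  rw [Matrix.mulVec_smul, ← l2_unitary_mulVec hU (thetaTwo Λ e R)]
  change normalize (QFTZMod.qftMatrix ι R *ᵥ thetaTwo Λ e R) = _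
  unfold thetaTwo
  rw [hF]
  exact normalize_const_mul (qftConst_pos Λ R) _

/-! ### Short points of cosets of `RL` are unique when `λ₁(RL) > 2√n` -/

section Decode

variable {Λ e R}

/-- `t` is GOOD when its coset `u_t + RL` contains a point of norm `< √n`. [cite: Regev2009, Lemma 3.14] -/
def Good (t : ι → ZMod R) : Prop :=
  ∃ z ∈ scaledLattice (primalLattice Λ e R) R, ‖reprPt (primalLattice Λ e R) (primalZBasis Λ e R) R t + z‖ < Real.sqrt (finrank ℝ V)

/-- The hypothesis `λ₁(RL) > 2√n` in the form used: a vector of `RL` of norm `< 2√n` is `0`.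
[cite: Regev2009, Lemma 3.14 (proof: "λ₁(RL) ≥ 2^{3n} > √n" / the footnote's `2√n`)] -/
def ShortVectorsTrivial (Λ : Submodule ℤ V) [DiscreteTopology Λ] [IsZLattice ℝ Λ] (e : Basis ι ℤ Λ) (R : ℕ) [NeZero R] : Prop :=
  ∀ z ∈ scaledLattice (primalLattice Λ e R) R, ‖z‖ < 2 * Real.sqrt (finrank ℝ V) → z = 0

/-- A DECODER: returns the short point of the coset whenever there is one (e.g. Babai's nearest
plane on an LLL basis of `RL`; what it returns otherwise is irrelevant). [cite: Regev2009, Lemma 3.14 ("we can recover x by using, e.g., Babai's nearest plane algorithm")] -/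
def IsDecoder (Λ : Submodule ℤ V) [DiscreteTopology Λ] [IsZLattice ℝ Λ] (e : Basis ι ℤ Λ) (R : ℕ) [NeZero R]
    (dec : (ι → ZMod R) → V) : Prop :=
  ∀ t, ∀ z ∈ scaledLattice (primalLattice Λ e R) R,
    ‖reprPt (primalLattice Λ e R) (primalZBasis Λ e R) R t + z‖ < Real.sqrt (finrank ℝ V) →
      dec t = reprPt (primalLattice Λ e R) (primalZBasis Λ e R) R t + z

variable (hsv : ShortVectorsTrivial Λ e R)
include hsv

omit [MeasurableSpace V] [BorelSpace V] in
/-- Under `λ₁(RL) > 2√n`, two short points of the same coset coincide. [cite: Regev2009, Lemma 3.14] -/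
theorem short_unique {t : ι → ZMod R} {z z' : V} (hz : z ∈ scaledLattice (primalLattice Λ e R) R)
    (hz' : z' ∈ scaledLattice (primalLattice Λ e R) R)
    (h1 : ‖reprPt (primalLattice Λ e R) (primalZBasis Λ e R) R t + z‖ < Real.sqrt (finrank ℝ V))
    (h2 : ‖reprPt (primalLattice Λ e R) (primalZBasis Λ e R) R t + z'‖ < Real.sqrt (finrank ℝ V)) : z = z' := by
  have hd : ‖z - z'‖ < 2 * Real.sqrt (finrank ℝ V) := by
    have : z - z' = (reprPt (primalLattice Λ e R) (primalZBasis Λ e R) R t + z) -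
        (reprPt (primalLattice Λ e R) (primalZBasis Λ e R) R t + z') := by abel
    rw [this]
    exact (norm_sub_le _ _).trans_lt (by linarith)
  exact sub_eq_zero.1 (hsv _ (Submodule.sub_mem _ hz hz') hd)

omit [MeasurableSpace V] [BorelSpace V] in
/-- **`ϑ₁'(t) = ρ(u_t + z)` for a good `t` with short point `u_t + z`** (the truncated coset sum has
exactly one term). [cite: Regev2009, Lemma 3.14 ("the probability of obtaining x is proportional to ρ(x)²")] -/
theorem truncAmp_primal_eq_of_short {t : ι → ZMod R} {z : V} (hz : z ∈ scaledLattice (primalLattice Λ e R) R)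
    (h1 : ‖reprPt (primalLattice Λ e R) (primalZBasis Λ e R) R t + z‖ < Real.sqrt (finrank ℝ V)) :
    truncAmp (primalLattice Λ e R) (primalZBasis Λ e R) R t =
      gaussianFunction 1 (reprPt (primalLattice Λ e R) (primalZBasis Λ e R) R t + z) := by
  set u := reprPt (primalLattice Λ e R) (primalZBasis Λ e R) R t with hu
  have hset : (scaledLattice (primalLattice Λ e R) R : Set V) ∩ ball (-u) (Real.sqrt (finrank ℝ V)) = {z} := by
    ext w
    simp only [Set.mem_inter_iff, SetLike.mem_coe, mem_ball, dist_eq_norm, sub_neg_eq_add, Set.mem_singleton_iff]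
    constructor
    · rintro ⟨hw, hwn⟩
      rw [add_comm] at hwn
      exact short_unique hsv hw hz hwn h1
    · rintro rfl
      exact ⟨hz, by rwa [add_comm]⟩
  have hsingle : gaussianMass 1 (-u) ({z} : Set V) = ENNReal.ofReal (gaussianFunction 1 (z - -u)) := by
    unfold gaussianMass
    exact tsum_singleton z (fun x : V => ENNReal.ofReal (gaussianFunction 1 (x - -u)))
  rw [truncAmp, hset, hsingle, ENNReal.toReal_ofReal (gaussianFunction_pos _ _).le, sub_neg_eq_add, add_comm]

omit [MeasurableSpace V] [BorelSpace V] hsv in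
/-- **`ϑ₁'(t) = 0` for a bad `t`** (empty truncated coset sum). [cite: Regev2009, Lemma 3.14] -/
theorem truncAmp_primal_eq_zero {t : ι → ZMod R} (ht : ¬ Good (Λ := Λ) (e := e) (R := R) t) :
    truncAmp (primalLattice Λ e R) (primalZBasis Λ e R) R t = 0 := by
  set u := reprPt (primalLattice Λ e R) (primalZBasis Λ e R) R t with hu
  have hset : (scaledLattice (primalLattice Λ e R) R : Set V) ∩ ball (-u) (Real.sqrt (finrank ℝ V)) = ∅ := by
    ext w
    simp only [Set.mem_inter_iff, SetLike.mem_coe, mem_ball, dist_eq_norm, sub_neg_eq_add, Set.mem_empty_iff_false,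
      iff_false, not_and]
    intro hw hwn
    exact ht ⟨w, hw, by rwa [add_comm]⟩
  rw [truncAmp, hset, gaussianMass, tsum_empty, ENNReal.toReal_zero]

end Decode

/-! ### The ideal output law: `D_{L,1/√2}` conditioned on the ball -/

section IdealLaw

open Classical

variable {Λ e R}
variable (hsv : ShortVectorsTrivial Λ e R) {dec : (ι → ZMod R) → V} (hdec : IsDecoder Λ e R dec)

local notation "Lp" => primalLattice Λ e R
local notation "bp" => primalZBasis Λ e R
local notation "rn" => Real.sqrt (finrank ℝ V)

omit [InnerProductSpace ℝ V] [FiniteDimensional ℝ V] [MeasurableSpace V] [BorelSpace V] in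
/-- `ρ(x)² = ρ_{1/√2}(x)`. [cite: Regev2009, Lemma 3.14 ("ρ(x)² = ρ_{1/√2}(x)")] -/
theorem gaussianFunction_one_sq (x : V) : gaussianFunction 1 x ^ 2 = gaussianFunction (Real.sqrt 2)⁻¹ x := by
  rw [gaussianFunction, gaussianFunction, sq, ← Real.exp_add]
  congr 1
  rw [inv_pow, Real.sq_sqrt zero_le_two]
  ring

include hdec

omit [MeasurableSpace V] [BorelSpace V] in
/-- For a good `t` the decoder returns the short point `u_t + z`. [cite: Regev2009, Lemma 3.14] -/
theorem exists_dec_eq {t : ι → ZMod R} (ht : Good (Λ := Λ) (e := e) (R := R) t) :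
    ∃ z ∈ scaledLattice Lp R, ‖reprPt Lp bp R t + z‖ < rn ∧ dec t = reprPt Lp bp R t + z := by
  obtain ⟨z, hz, hlt⟩ := ht
  exact ⟨z, hz, hlt, hdec t z hz hlt⟩

omit [MeasurableSpace V] [BorelSpace V] in
/-- For a good `t`, `dec t ∈ L`. [folklore] -/
theorem dec_mem {t : ι → ZMod R} (ht : Good (Λ := Λ) (e := e) (R := R) t) : dec t ∈ Lp := by
  obtain ⟨z, hz, -, h⟩ := exists_dec_eq hdec ht
  rw [h]
  exact Submodule.add_mem _ (reprPt_mem _ _ R t) (scaledLattice_le _ R hz)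

omit [MeasurableSpace V] [BorelSpace V] in
/-- For a good `t`, `‖dec t‖ < √n`. [folklore] -/
theorem norm_dec_lt {t : ι → ZMod R} (ht : Good (Λ := Λ) (e := e) (R := R) t) : ‖dec t‖ < rn := by
  obtain ⟨z, -, hlt, h⟩ := exists_dec_eq hdec ht
  rwa [h]

omit [MeasurableSpace V] [BorelSpace V] in
/-- **Distinct good `t` decode to distinct points** (their representatives are distinct modulo `RL`).
[cite: Regev2009, Lemma 3.14] -/
theorem dec_injOn : Set.InjOn dec {t | Good (Λ := Λ) (e := e) (R := R) t} := by
  intro t ht t' ht' h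
  obtain ⟨z, hz, -, hd⟩ := exists_dec_eq hdec ht
  obtain ⟨z', hz', -, hd'⟩ := exists_dec_eq hdec ht'
  have hdiff : reprPt Lp bp R t - reprPt Lp bp R t' ∈ scaledLattice Lp R := by
    have : reprPt Lp bp R t - reprPt Lp bp R t' = z' - z := by
      have h2 : reprPt Lp bp R t + z = reprPt Lp bp R t' + z' := by rw [← hd, ← hd', h]
      exact sub_eq_sub_iff_add_eq_add.2 (by rw [h2, add_comm])
    rw [this]
    exact Submodule.sub_mem _ hz' hz
  -- the transversal property: both representatives represent `reprPt t`
  have hT := isTransversal_reprSet Lp bp R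
  obtain ⟨x, -, hxu⟩ := hT.unique _ (reprPt_mem Lp bp R t)
  have h1 : reprPt Lp bp R t = x := hxu _ ⟨(mem_reprSet Lp bp).2 ⟨t, rfl⟩, by rw [sub_self]; exact Submodule.zero_mem _⟩
  have h2 : reprPt Lp bp R t' = x := hxu _ ⟨(mem_reprSet Lp bp).2 ⟨t', rfl⟩, hdiff⟩
  exact reprPt_injective Lp bp R (h1.trans h2.symm)

omit [MeasurableSpace V] [BorelSpace V] in
/-- **Every short lattice point is decoded from some good `t`.** [cite: Regev2009, Lemma 3.14] -/
theorem exists_good_dec_eq {x : V} (hx : x ∈ Lp) (hxn : ‖x‖ < rn) :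
    ∃ t, Good (Λ := Λ) (e := e) (R := R) t ∧ dec t = x := by
  have hT := isTransversal_reprSet Lp bp R
  obtain ⟨x₀, ⟨hx₀, hxx₀⟩, -⟩ := hT.unique x hx
  obtain ⟨t, rfl⟩ := (mem_reprSet Lp bp).1 hx₀
  have hlt : ‖reprPt Lp bp R t + (x - reprPt Lp bp R t)‖ < rn := by rwa [add_sub_cancel]
  refine ⟨t, ⟨_, hxx₀, hlt⟩, ?_⟩
  rw [hdec t _ hxx₀ hlt, add_sub_cancel]

include hsv

omit [MeasurableSpace V] [BorelSpace V] in
/-- **`ϑ₁'(t)² = ρ_{1/√2}(dec t)` for good `t`, `0` otherwise.** [cite: Regev2009, Lemma 3.14 ("the probability of obtaining x … is proportional to ρ(x)² = ρ_{1/√2}(x)")] -/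
theorem truncAmp_primal_sq_eq (t : ι → ZMod R) :
    truncAmp Lp bp R t ^ 2 = if Good (Λ := Λ) (e := e) (R := R) t then gaussianFunction (Real.sqrt 2)⁻¹ (dec t) else 0 := by
  split_ifs with ht
  · obtain ⟨z, hz, hlt, h⟩ := exists_dec_eq hdec ht
    rw [truncAmp_primal_eq_of_short hsv hz hlt, gaussianFunction_one_sq, h]
  · rw [truncAmp_primal_eq_zero ht]; ring

omit [MeasurableSpace V] [BorelSpace V] in
/-- **The ideal output law, unnormalised**: for every event `A ⊆ V`,
`∑_{t : dec t ∈ A} ϑ₁'(t)² = ρ_{1/√2}(L ∩ A ∩ √n B)`. [cite: Regev2009, Lemma 3.14 ("the probability of obtaining any x ∈ L, ‖x‖ < √n is proportional to ρ_{1/√2}(x)")] -/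
theorem sum_truncAmp_sq_eq (A : Set V) :
    ∑ t ∈ Finset.univ.filter (fun t => dec t ∈ A), truncAmp Lp bp R t ^ 2 =
      (gaussianMass (Real.sqrt 2)⁻¹ 0 ((Lp : Set V) ∩ (A ∩ ball 0 rn))).toReal := by
  -- the decoding map into `L`
  set Φ : (ι → ZMod R) → Lp := fun t => if h : Good (Λ := Λ) (e := e) (R := R) t then ⟨dec t, dec_mem hdec h⟩ else 0 with hΦ
  have hΦval : ∀ t, Good (Λ := Λ) (e := e) (R := R) t → ((Φ t : Lp) : V) = dec t := fun t ht => by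
    simp only [hΦ, dif_pos ht]
  set G : Lp → ℝ≥0∞ := fun y => (A ∩ ball (0 : V) rn).indicator (fun w => ENNReal.ofReal (gaussianFunction (Real.sqrt 2)⁻¹ (w - 0))) y
    with hG
  set SF : Finset Lp := (Finset.univ.filter fun t => Good (Λ := Λ) (e := e) (R := R) t).image Φ with hSF
  -- (a) the lattice sum is a finite sum over the decoded points
  have ha : gaussianMass (Real.sqrt 2)⁻¹ 0 ((Lp : Set V) ∩ (A ∩ ball 0 rn)) = ∑ y ∈ SF, G y := by
    rw [gaussianMass_inter_eq_tsum_indicator, tsum_eq_sum]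
    intro y hy
    by_contra hne
    have hyB : (y : V) ∈ A ∩ ball (0 : V) rn := by
      by_contra hout
      exact hne (Set.indicator_of_notMem hout _)
    have hyn : ‖(y : V)‖ < rn := by simpa using hyB.2
    obtain ⟨t, ht, hty⟩ := exists_good_dec_eq hdec y.2 hyn
    refine hy (Finset.mem_image.2 ⟨t, Finset.mem_filter.2 ⟨Finset.mem_univ _, ht⟩, Subtype.ext ?_⟩)
    rw [hΦval t ht, hty]
  -- (b) reindex by `t`
  have hb : ∑ y ∈ SF, G y = ∑ t ∈ Finset.univ.filter (fun t => Good (Λ := Λ) (e := e) (R := R) t), G (Φ t) := by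
    rw [hSF, Finset.sum_image]
    intro t ht t' ht' h
    have hg := (Finset.mem_filter.1 ht).2
    have hg' := (Finset.mem_filter.1 ht').2
    have hv : dec t = dec t' := by rw [← hΦval t hg, ← hΦval t' hg', h]
    exact dec_injOn hdec hg hg' hv
  -- (c) evaluate the indicator at decoded points
  have hc : ∀ t, Good (Λ := Λ) (e := e) (R := R) t →
      G (Φ t) = if dec t ∈ A then ENNReal.ofReal (gaussianFunction (Real.sqrt 2)⁻¹ (dec t)) else 0 := by
    intro t ht
    simp only [hG, hΦval t ht, Set.indicator, Set.mem_inter_iff, mem_ball, dist_zero_right, sub_zero]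
    by_cases hA : dec t ∈ A
    · rw [if_pos ⟨hA, norm_dec_lt hdec ht⟩, if_pos hA]
    · rw [if_neg (fun h => hA h.1), if_neg hA]
  -- (d) assemble
  rw [ha, hb, Finset.sum_congr rfl fun t ht => hc t (Finset.mem_filter.1 ht).2,
    ENNReal.toReal_sum (fun t _ => by split_ifs <;> simp), Finset.sum_filter, Finset.sum_filter]
  refine Finset.sum_congr rfl fun t _ => ?_
  rw [truncAmp_primal_sq_eq hsv hdec]
  by_cases hg : Good (Λ := Λ) (e := e) (R := R) t
  · by_cases hA : dec t ∈ A
    · simp [hg, hA, ENNReal.toReal_ofReal (gaussianFunction_pos _ _).le]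
    · simp [hg, hA]
  · simp [hg]

omit [MeasurableSpace V] [BorelSpace V] in
/-- **The normalising constant**: `∑_t ϑ₁'(t)² = ρ_{1/√2}(L ∩ √n B)`. [cite: Regev2009, Lemma 3.14] -/
theorem sum_truncAmp_sq_univ :
    ∑ t : ι → ZMod R, truncAmp Lp bp R t ^ 2 = (gaussianMass (Real.sqrt 2)⁻¹ 0 ((Lp : Set V) ∩ ball 0 rn)).toReal := by
  have h := sum_truncAmp_sq_eq hsv hdec (Set.univ : Set V)
  rw [Finset.sum_filter, Set.univ_inter] at h
  simpa only [Set.mem_univ, if_true] using h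

end IdealLaw

/-! ### Conditioning on the ball costs at most `2⁻ⁿ` -/

section Conditioning

omit [MeasurableSpace V] [BorelSpace V]

/-- The elementary inequality behind conditioning: for `0 ≤ p ≤ z`, `0 ≤ q ≤ w`, `0 < z`,
`|p/z − (p+q)/(z+w)| ≤ w/(z+w)`. [folklore] -/
theorem abs_div_sub_div_le {p q z w : ℝ} (hp : 0 ≤ p) (hpz : p ≤ z) (hq : 0 ≤ q) (hqw : q ≤ w) (hz : 0 < z) :
    |p / z - (p + q) / (z + w)| ≤ w / (z + w) := by
  have hw : 0 ≤ w := hq.trans hqw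
  have hzw : 0 < z + w := by linarith
  have key : p / z - (p + q) / (z + w) = (p * w - q * z) / (z * (z + w)) := by
    field_simp
    ring
  rw [key, abs_div, abs_of_pos (mul_pos hz hzw), div_le_div_iff₀ (mul_pos hz hzw) hzw]
  have hnum : |p * w - q * z| ≤ z * w := by
    rw [abs_le]
    constructor <;> nlinarith [mul_le_mul_of_nonneg_right hpz hw, mul_le_mul_of_nonneg_right hqw hz.le]
  calc |p * w - q * z| * (z + w) ≤ z * w * (z + w) := mul_le_mul_of_nonneg_right hnum hzw.le
    _ = w * (z * (z + w)) := by ring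

variable (M : Submodule ℤ V) [DiscreteTopology M] [IsZLattice ℝ M]

omit [IsZLattice ℝ M] in
/-- **The discrete Gaussian of an event as a ratio of Gaussian masses**:
`D_{M,s}(A) = ρ_s(M ∩ A)/ρ_s(M)`. [cite: MicciancioRegev2007, §2 (definition of D_{L,s})] -/
theorem toReal_toOuterMeasure_discreteGaussian_eq {s : ℝ} (hs : 0 < s) (A : Set V) :
    ((discreteGaussian M s 0).toOuterMeasure {x : M | (x : V) ∈ A}).toReal =
      (gaussianMass s 0 ((M : Set V) ∩ A)).toReal / (gaussianMass s 0 (M : Set V)).toReal := by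
  rw [PMF.toOuterMeasure_apply]
  have h : ∀ x : M, ({x : M | (x : V) ∈ A} : Set M).indicator (discreteGaussian M s 0) x =
      A.indicator (fun w => ENNReal.ofReal (gaussianFunction s (w - 0))) x * (gaussianMass s 0 (M : Set V))⁻¹ := by
    intro x
    simp only [Set.indicator, Set.mem_setOf_eq]
    split_ifs with hx
    · rw [discreteGaussian_apply M hs]
    · rw [zero_mul]
  simp_rw [h]
  rw [ENNReal.tsum_mul_right, ← gaussianMass_inter_eq_tsum_indicator, ENNReal.toReal_mul, ENNReal.toReal_inv,
    div_eq_mul_inv]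

omit [IsZLattice ℝ M] in
/-- **Conditioning `D_{M,s}` on an event `B` moves probabilities by at most `D_{M,s}(Bᶜ)`**:
`|ρ(M∩A∩B)/ρ(M∩B) − ρ(M∩A)/ρ(M)| ≤ ρ(M∖B)/ρ(M)`. [folklore] -/
theorem abs_cond_sub_le {s : ℝ} (hs : 0 < s) (A B : Set V) (hB : 0 < (gaussianMass s 0 ((M : Set V) ∩ B)).toReal) :
    |(gaussianMass s 0 ((M : Set V) ∩ (A ∩ B))).toReal / (gaussianMass s 0 ((M : Set V) ∩ B)).toReal -
        (gaussianMass s 0 ((M : Set V) ∩ A)).toReal / (gaussianMass s 0 (M : Set V)).toReal| ≤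
      (gaussianMass s 0 ((M : Set V) \ B)).toReal / (gaussianMass s 0 (M : Set V)).toReal := by
  have hfin : gaussianMass s 0 (M : Set V) ≠ ⊤ := gaussianMass_lattice_ne_top M hs.ne' 0
  have hfin' : ∀ S : Set V, gaussianMass s 0 ((M : Set V) ∩ S) ≠ ⊤ := fun S =>
    ne_top_of_le_ne_top hfin (gaussianMass_mono _ _ Set.inter_subset_left)
  -- decompose `ρ(M ∩ A) = ρ(M ∩ A ∩ B) + ρ((M ∩ A) ∖ B)` and `ρ(M) = ρ(M ∩ B) + ρ(M ∖ B)`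
  have hA : (gaussianMass s 0 ((M : Set V) ∩ A)).toReal =
      (gaussianMass s 0 ((M : Set V) ∩ (A ∩ B))).toReal + (gaussianMass s 0 (((M : Set V) ∩ A) \ B)).toReal := by
    rw [gaussianMass_eq_inter_add_diff s 0 ((M : Set V) ∩ A) B, Set.inter_assoc, ENNReal.toReal_add (hfin' _)
      (ne_top_of_le_ne_top hfin (gaussianMass_mono _ _ (Set.sdiff_subset.trans Set.inter_subset_left)))]
  have hM : (gaussianMass s 0 (M : Set V)).toReal =
      (gaussianMass s 0 ((M : Set V) ∩ B)).toReal + (gaussianMass s 0 ((M : Set V) \ B)).toReal := by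
    rw [gaussianMass_eq_inter_add_diff s 0 (M : Set V) B, ENNReal.toReal_add (hfin' _)
      (ne_top_of_le_ne_top hfin (gaussianMass_mono _ _ Set.sdiff_subset))]
  rw [hA, hM]
  refine abs_div_sub_div_le ENNReal.toReal_nonneg ?_ ENNReal.toReal_nonneg ?_ hB
  · exact ENNReal.toReal_mono (hfin' _) (gaussianMass_mono _ _ (Set.inter_subset_inter_right _ Set.inter_subset_right))
  · exact ENNReal.toReal_mono (ne_top_of_le_ne_top hfin (gaussianMass_mono _ _ Set.sdiff_subset))
      (gaussianMass_mono _ _ (Set.sdiff_subset_sdiff_left Set.inter_subset_left))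

/-- **Banaszczyk at `s = 1/√2`**: `ρ_{1/√2}(M ∖ √n B)/ρ_{1/√2}(M) ≤ 2⁻ⁿ` ("by Lemma 2.5, all but an
exponentially small fraction of `D_{L,1/√2}` is on points of norm less than `√n`").
[cite: Regev2009, Lemma 3.14 (end of proof), Lemma 2.5] -/
theorem gaussianMass_diff_ball_div_le :
    (gaussianMass (Real.sqrt 2)⁻¹ 0 ((M : Set V) \ ball 0 (Real.sqrt (finrank ℝ V)))).toReal /
        (gaussianMass (Real.sqrt 2)⁻¹ 0 (M : Set V)).toReal ≤ (2⁻¹ : ℝ) ^ finrank ℝ V := by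
  have hs : (0 : ℝ) < (Real.sqrt 2)⁻¹ := inv_pos.2 (Real.sqrt_pos.2 two_pos)
  have hfin : gaussianMass (Real.sqrt 2)⁻¹ 0 (M : Set V) ≠ ⊤ := gaussianMass_lattice_ne_top M hs.ne' 0
  have hpos : 0 < (gaussianMass (Real.sqrt 2)⁻¹ 0 (M : Set V)).toReal :=
    ENNReal.toReal_pos (gaussianMass_lattice_ne_zero M _ 0) hfin
  have hB := gaussianMass_diff_ball_le_holds M hs
  -- the smaller ball `(1/√2)√n B ⊆ √n B`
  have hsub : (M : Set V) \ ball 0 (Real.sqrt (finrank ℝ V)) ⊆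
      (M : Set V) \ ball 0 ((Real.sqrt 2)⁻¹ * Real.sqrt (finrank ℝ V)) := by
    refine Set.sdiff_subset_sdiff_right (ball_subset_ball ?_)
    have h1 : (Real.sqrt 2)⁻¹ ≤ 1 := inv_le_one_of_one_le₀ (Real.one_le_sqrt.2 one_le_two)
    nlinarith [Real.sqrt_nonneg (finrank ℝ V : ℝ)]
  have h := (gaussianMass_mono _ _ hsub).trans hB
  have hr := ENNReal.toReal_mono (ENNReal.mul_ne_top (ENNReal.pow_ne_top (by simp)) hfin) h
  rw [ENNReal.toReal_mul, ENNReal.toReal_pow, ENNReal.toReal_inv, ENNReal.toReal_ofNat] at hr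
  rwa [div_le_iff₀ hpos]

end Conditioning

/-! ### The hypothesis `λ₁(RL) > 2√n` from `λₙ(L*)/R ≤ 2^{-3n}` -/

section Hypothesis

omit [MeasurableSpace V] [BorelSpace V]

/-- `RL = Λ*`: the hypothesis in terms of the dual lattice of `Λ`. [cite: Regev2009, Lemma 3.14 ("(L*/R)* = RL")] -/
theorem shortVectorsTrivial_of_dual
    (h : ∀ z ∈ dualLattice Λ, ‖z‖ < 2 * Real.sqrt (finrank ℝ V) → z = 0) : ShortVectorsTrivial Λ e R := by
  intro z hz hzn
  rw [scaledLattice_primalLattice] at hz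
  exact h z hz hzn

/-- **Regev's hypothesis `R ≥ 2^{3n} λₙ(L*)` gives `λ₁(RL) > 2√n`**: with `Λ = L*/R` it reads
`λₙ(Λ) ≤ 2^{-3n}`, and by the lower transference bound `λₙ(Λ) λ₁(Λ*) ≥ 1` every nonzero vector of
`Λ* = RL` has norm `≥ 2^{3n} ≥ 2√n`. [cite: Regev2009, Lemma 3.14 (proof: "by Lemma 2.3, λ₁(RL) ≥ 2^{3n} > √n")] -/
theorem shortVectorsTrivial_of_successiveMinimum_le [Nontrivial V]
    (hΛ : successiveMinimum Λ (finrank ℝ V) ≤ (2⁻¹ : ℝ) ^ (3 * finrank ℝ V)) : ShortVectorsTrivial Λ e R := by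
  refine shortVectorsTrivial_of_dual Λ e R fun z hz hzn => ?_
  by_contra hz0
  set n := finrank ℝ V with hn
  have hn1 : 1 ≤ n := Module.finrank_pos
  have hnR : (1 : ℝ) ≤ n := by exact_mod_cast hn1
  -- `1 ≤ λₙ(Λ) λ₁(Λ*)` and `λ₁(Λ*) ≤ ‖z‖`
  have ht := one_le_successiveMinimum_mul_dual_holds Λ (i := n) hn1 le_rfl
  rw [show n + 1 - n = 1 by omega, successiveMinimum_one_eq_minNorm_holds (dualLattice Λ)] at ht
  have hmin : minNorm (dualLattice Λ) ≤ ‖z‖ := minNorm_le_norm_of_mem_of_ne_zero (dualLattice Λ) hz hz0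
  have hl0 : 0 ≤ successiveMinimum Λ n := successiveMinimum_nonneg Λ n
  have h1 : 1 ≤ successiveMinimum Λ n * ‖z‖ := ht.trans (mul_le_mul_of_nonneg_left hmin hl0)
  -- but `λₙ(Λ) ‖z‖ < 2^{-3n} · 2√n ≤ 1`
  have hsn : Real.sqrt n ≤ n := by
    rw [Real.sqrt_le_left (by positivity)]
    nlinarith
  have h2n : (n : ℝ) ≤ 2 ^ n := by exact_mod_cast (Nat.lt_two_pow_self).le
  have h8 : (2 : ℝ) * Real.sqrt n ≤ 2 ^ (3 * n) := by
    calc (2 : ℝ) * Real.sqrt n ≤ 2 * 2 ^ n := by nlinarith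
      _ = 2 ^ (n + 1) := by ring
      _ ≤ 2 ^ (3 * n) := pow_le_pow_right₀ one_le_two (by omega)
  have h2 : successiveMinimum Λ n * ‖z‖ < 1 := by
    calc successiveMinimum Λ n * ‖z‖ ≤ (2⁻¹ : ℝ) ^ (3 * n) * ‖z‖ := mul_le_mul_of_nonneg_right hΛ (norm_nonneg _)
      _ < (2⁻¹ : ℝ) ^ (3 * n) * (2 * Real.sqrt n) := mul_lt_mul_of_pos_left hzn (by positivity)
      _ ≤ (2⁻¹ : ℝ) ^ (3 * n) * 2 ^ (3 * n) := mul_le_mul_of_nonneg_left h8 (by positivity)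
      _ = 1 := by rw [inv_pow, inv_mul_cancel₀ (by positivity)]
  linarith

end Hypothesis

/-! ### Lemma 3.14, ideal form -/

section Main

open Classical

omit [MeasurableSpace V] [BorelSpace V] in
/-- `|f̂(t)|² = |f(t)|²/‖f‖₂²`. [folklore] -/
theorem norm_normalize_apply_sq {X : Type*} [Fintype X] (f : X → ℂ) (t : X) :
    ‖normalize f t‖ ^ 2 = ‖f t‖ ^ 2 / l2 f ^ 2 := by
  rw [QState.normalize, Pi.smul_apply, norm_smul, Real.norm_eq_abs, abs_inv, abs_of_nonneg (l2_nonneg f), mul_pow,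
    inv_pow, div_eq_inv_mul]

omit [MeasurableSpace V] [BorelSpace V] in
/-- The auxiliary data of the analysis: positivity of the normalising constant, the normalised
ideal state `θ = ϑ̂₁'` is a unit vector, its decoded measurement law is `D_{L,1/√2}` conditioned on
the ball, and conditioning costs at most `2⁻ⁿ`: **`|∑_{t : dec t ∈ A} |θ(t)|² − D_{L,1/√2}(A)| ≤ 2⁻ⁿ`**.
[cite: Regev2009, Lemma 3.14 (end of proof)] -/
theorem ideal_law_bound [Nontrivial V] (hsv : ShortVectorsTrivial Λ e R) {dec : (ι → ZMod R) → V}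
    (hdec : IsDecoder Λ e R dec) (A : Set V) :
    l2 (normalize (thetaOne' Λ e R)) = 1 ∧
    |∑ t ∈ Finset.univ.filter (fun t => dec t ∈ A), ‖normalize (thetaOne' Λ e R) t‖ ^ 2 -
        ((discreteGaussian (primalLattice Λ e R) (Real.sqrt 2)⁻¹ 0).toOuterMeasure
          {x : primalLattice Λ e R | (x : V) ∈ A}).toReal| ≤ (2⁻¹ : ℝ) ^ finrank ℝ V := by
  have hs : (0 : ℝ) < (Real.sqrt 2)⁻¹ := inv_pos.2 (Real.sqrt_pos.2 two_pos)
  have hn : (0 : ℝ) < Real.sqrt (finrank ℝ V) := Real.sqrt_pos.2 (by exact_mod_cast Module.finrank_pos)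
  have hZeq := sum_truncAmp_sq_univ hsv hdec
  have hBfin : gaussianMass (Real.sqrt 2)⁻¹ 0 ((primalLattice Λ e R : Set V) ∩ ball 0 (Real.sqrt (finrank ℝ V))) ≠ ⊤ :=
    ne_top_of_le_ne_top (gaussianMass_lattice_ne_top (primalLattice Λ e R) hs.ne' 0) (gaussianMass_mono _ _ Set.inter_subset_left)
  have hBpos : 0 < (gaussianMass (Real.sqrt 2)⁻¹ 0 ((primalLattice Λ e R : Set V) ∩ ball 0 (Real.sqrt (finrank ℝ V)))).toReal := by
    refine ENNReal.toReal_pos (ne_of_gt ?_) hBfin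
    have h0 : ({0} : Set V) ⊆ (primalLattice Λ e R : Set V) ∩ ball 0 (Real.sqrt (finrank ℝ V)) :=
      Set.singleton_subset_iff.2 ⟨Submodule.zero_mem _, mem_ball_self hn⟩
    refine lt_of_lt_of_le ?_ (gaussianMass_mono _ _ h0)
    unfold gaussianMass
    rw [tsum_singleton (0 : V) (fun x : V => ENNReal.ofReal (gaussianFunction (Real.sqrt 2)⁻¹ (x - 0)))]
    exact ENNReal.ofReal_pos.2 (gaussianFunction_pos _ _)
  have hl2sq : l2 (thetaOne' Λ e R) ^ 2 = ∑ t : ι → ZMod R, truncAmp (primalLattice Λ e R) (primalZBasis Λ e R) R t ^ 2 := by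
    rw [l2_sq]
    refine Finset.sum_congr rfl fun t _ => ?_
    rw [thetaOne', Complex.norm_real, Real.norm_eq_abs, sq_abs]
  have hθ1ne : thetaOne' Λ e R ≠ 0 := by
    intro h0
    have : l2 (thetaOne' Λ e R) ^ 2 = 0 := by rw [h0, (l2_eq_zero_iff _).2 rfl]; ring
    rw [hl2sq, hZeq] at this
    exact hBpos.ne' this
  refine ⟨l2_normalize hθ1ne, ?_⟩
  have hideal : ∑ t ∈ Finset.univ.filter (fun t => dec t ∈ A), ‖normalize (thetaOne' Λ e R) t‖ ^ 2 =
      (gaussianMass (Real.sqrt 2)⁻¹ 0 ((primalLattice Λ e R : Set V) ∩ (A ∩ ball 0 (Real.sqrt (finrank ℝ V))))).toReal /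
        (gaussianMass (Real.sqrt 2)⁻¹ 0 ((primalLattice Λ e R : Set V) ∩ ball 0 (Real.sqrt (finrank ℝ V)))).toReal := by
    rw [← sum_truncAmp_sq_eq hsv hdec A, ← hZeq, ← hl2sq, Finset.sum_div]
    refine Finset.sum_congr rfl fun t _ => ?_
    rw [norm_normalize_apply_sq, thetaOne', Complex.norm_real, Real.norm_eq_abs, sq_abs]
  rw [hideal, toReal_toOuterMeasure_discreteGaussian_eq (primalLattice Λ e R) hs A]
  exact (abs_cond_sub_le (primalLattice Λ e R) hs A (ball 0 (Real.sqrt (finrank ℝ V))) hBpos).trans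
    (gaussianMass_diff_ball_div_le (primalLattice Λ e R))

/-- **`‖F ϑ̂₁ − ϑ̂₁'‖₂ ≤ 4·2⁻ⁿ`**: the QFT of the normalised truncated state is close to the normalised
truncated dual state (`F ϑ̂₂ = ϑ̂₂'` and Claim 3.13 on both sides). [cite: Regev2009, Lemma 3.14] -/
theorem l2_qft_normalize_thetaOne_sub_le [Nontrivial V] :
    l2 (QFTZMod.qftMatrix ι R *ᵥ normalize (thetaOne Λ e R) - normalize (thetaOne' Λ e R)) ≤
      4 * (2⁻¹ : ℝ) ^ finrank ℝ V := by
  set F := QFTZMod.qftMatrix ι R with hFdef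
  have hU : F ∈ Matrix.unitaryGroup (ι → ZMod R) ℂ := QFTZMod.qftMatrix_mem_unitaryGroup (ι := ι) R
  have hstep2 : l2 (F *ᵥ normalize (thetaOne Λ e R) - F *ᵥ normalize (thetaTwo Λ e R)) ≤ 2 * (2⁻¹ : ℝ) ^ finrank ℝ V := by
    rw [← Matrix.mulVec_sub, l2_unitary_mulVec hU, l2_sub_comm]
    exact l2_normalize_thetaTwo_sub_normalize_thetaOne_le Λ e
  have hstep3 : l2 (F *ᵥ normalize (thetaTwo Λ e R) - normalize (thetaOne' Λ e R)) ≤ 2 * (2⁻¹ : ℝ) ^ finrank ℝ V := by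
    rw [hFdef, qft_normalize_thetaTwo]
    exact l2_normalize_thetaTwo_sub_normalize_thetaOne_le (primalLattice Λ e R) (primalZBasis Λ e R)
  calc l2 (F *ᵥ normalize (thetaOne Λ e R) - normalize (thetaOne' Λ e R))
      ≤ l2 (F *ᵥ normalize (thetaOne Λ e R) - F *ᵥ normalize (thetaTwo Λ e R)) +
          l2 (F *ᵥ normalize (thetaTwo Λ e R) - normalize (thetaOne' Λ e R)) := l2_sub_le _ _ _
    _ ≤ 2 * (2⁻¹ : ℝ) ^ finrank ℝ V + 2 * (2⁻¹ : ℝ) ^ finrank ℝ V := add_le_add hstep2 hstep3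
    _ = 4 * (2⁻¹ : ℝ) ^ finrank ℝ V := by ring

/-- **Regev 2009, Lemma 3.14 (the quantum step), ideal form.** Let `Λ = L*/R` carry the
`ℤ`-basis `e`, let `F` be the QFT on `ℤ_Rⁿ`, assume `λ₁(RL) > 2√n` (`ShortVectorsTrivial`), let `dec`
be a decoder returning the short point of `u_t + RL` whenever there is one (`IsDecoder`), and let
`ψ` be any unit vector within `η` of the normalised truncated periodic Gaussian state `ϑ̂₁` (the
state the first step prepares up to an exponentially small error). Then for every event `A ⊆ V`,
measuring `Fψ` and decoding gives `A` with probability within `2η + 9·2⁻ⁿ` of `D_{L,1/√2}(A)`: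
`|∑_{t : dec t ∈ A} |(Fψ)(t)|² − D_{L,1/√2}(A)| ≤ 2η + 9·2⁻ⁿ`. The proof is the printed one:
`F ϑ̂₂ = ϑ̂₂'` (Poisson summation), `‖ϑ̂₂ − ϑ̂₁‖, ‖ϑ̂₂' − ϑ̂₁'‖ ≤ 2·2⁻ⁿ` (Claim 3.13 twice),
measurement statistics move by at most twice the `ℓ₂` distance, the ideal law is `D_{L,1/√2}`
conditioned on `‖x‖ < √n` (uniqueness of short coset points, `ρ(x)² = ρ_{1/√2}(x)`), and
conditioning costs `≤ 2⁻ⁿ` (Lemma 2.5). [cite: Regev2009, Lemma 3.14] -/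
theorem lemma_3_14_ideal [Nontrivial V] (hsv : ShortVectorsTrivial Λ e R) {dec : (ι → ZMod R) → V}
    (hdec : IsDecoder Λ e R dec) {ψ : (ι → ZMod R) → ℂ} (hψ : l2 ψ = 1) {η : ℝ}
    (hη : l2 (ψ - normalize (thetaOne Λ e R)) ≤ η) (A : Set V) :
    |∑ t ∈ Finset.univ.filter (fun t => dec t ∈ A), ‖(QFTZMod.qftMatrix ι R *ᵥ ψ) t‖ ^ 2 -
        ((discreteGaussian (primalLattice Λ e R) (Real.sqrt 2)⁻¹ 0).toOuterMeasure
          {x : primalLattice Λ e R | (x : V) ∈ A}).toReal| ≤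
      2 * η + 9 * (2⁻¹ : ℝ) ^ finrank ℝ V := by
  set F := QFTZMod.qftMatrix ι R with hFdef
  have hU : F ∈ Matrix.unitaryGroup (ι → ZMod R) ℂ := QFTZMod.qftMatrix_mem_unitaryGroup (ι := ι) R
  obtain ⟨hθunit, hlaw⟩ := ideal_law_bound Λ e R hsv hdec A
  have hFψunit : l2 (F *ᵥ ψ) = 1 := by rw [l2_unitary_mulVec hU, hψ]
  have hstep1 : l2 (F *ᵥ ψ - F *ᵥ normalize (thetaOne Λ e R)) ≤ η := by
    rw [← Matrix.mulVec_sub, l2_unitary_mulVec hU]; exact hη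
  have hdist : l2 (F *ᵥ ψ - normalize (thetaOne' Λ e R)) ≤ η + 4 * (2⁻¹ : ℝ) ^ finrank ℝ V :=
    (l2_sub_le _ _ _).trans (add_le_add hstep1 (l2_qft_normalize_thetaOne_sub_le Λ e R))
  have hmeas := abs_sum_filter_normSq_sub_le hFψunit hθunit (fun t => dec t ∈ A)
  have hfin := abs_sub_le (∑ t ∈ Finset.univ.filter (fun t => dec t ∈ A), ‖(F *ᵥ ψ) t‖ ^ 2)
    (∑ t ∈ Finset.univ.filter (fun t => dec t ∈ A), ‖normalize (thetaOne' Λ e R) t‖ ^ 2)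
    ((discreteGaussian (primalLattice Λ e R) (Real.sqrt 2)⁻¹ 0).toOuterMeasure
          {x : primalLattice Λ e R | (x : V) ∈ A}).toReal
  linarith

/-! ### With an auxiliary (work/garbage) register -/

section Aux

variable {Y : Type*} [Fintype Y]

omit [MeasurableSpace V] [BorelSpace V] in
/-- `‖f ⊗ g‖₂ = ‖f‖₂ ‖g‖₂` for product states on `X × Y`. [folklore] -/
theorem l2_tensor {X : Type*} [Fintype X] (f : X → ℂ) (g : Y → ℂ) :
    l2 (fun p : X × Y => f p.1 * g p.2) = l2 f * l2 g := by
  rw [l2_eq_sqrt, l2_eq_sqrt, l2_eq_sqrt, ← Real.sqrt_mul (Finset.sum_nonneg fun _ _ => by positivity),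
    Fintype.sum_prod_type, Finset.sum_mul_sum]
  congr 1
  refine Finset.sum_congr rfl fun x _ => Finset.sum_congr rfl fun y _ => ?_
  rw [norm_mul, mul_pow]

omit [MeasurableSpace V] [BorelSpace V] in
/-- **`F ⊗ I` is unitary** when `F` is. [folklore] -/
theorem kronecker_one_mem_unitaryGroup [DecidableEq Y] {X : Type*} [Fintype X] [DecidableEq X] {F : Matrix X X ℂ}
    (hF : F ∈ Matrix.unitaryGroup X ℂ) : F ⊗ₖ (1 : Matrix Y Y ℂ) ∈ Matrix.unitaryGroup (X × Y) ℂ := by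
  rw [Matrix.mem_unitaryGroup_iff'] at hF ⊢
  rw [Matrix.star_eq_conjTranspose, Matrix.conjTranspose_kronecker, ← Matrix.mul_kronecker_mul,
    Matrix.conjTranspose_one, one_mul, ← Matrix.star_eq_conjTranspose, hF, Matrix.one_kronecker_one]

omit [MeasurableSpace V] [BorelSpace V] in
/-- `(F ⊗ I)(f ⊗ g) = (F f) ⊗ g`. [folklore] -/
theorem kronecker_one_mulVec_tensor [DecidableEq Y] {X : Type*} [Fintype X] [DecidableEq X] (F : Matrix X X ℂ) (f : X → ℂ) (g : Y → ℂ) :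
    (F ⊗ₖ (1 : Matrix Y Y ℂ)) *ᵥ (fun p : X × Y => f p.1 * g p.2) = fun p : X × Y => (F *ᵥ f) p.1 * g p.2 := by
  funext p
  rcases p with ⟨t, a⟩
  simp only [Matrix.mulVec, dotProduct, Fintype.sum_prod_type, Matrix.kronecker_apply, Matrix.one_apply, mul_ite, mul_one,
    mul_zero, Finset.sum_mul]
  refine Finset.sum_congr rfl fun s _ => ?_
  rw [Finset.sum_eq_single a]
  · rw [if_pos rfl]; ring
  · intro y _ hy; rw [if_neg (Ne.symm hy)]; ring
  · intro h; exact absurd (Finset.mem_univ a) h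

omit [MeasurableSpace V] [BorelSpace V] in
/-- The marginal measurement law of a product state with a unit second factor. [folklore] -/
theorem sum_filter_normSq_tensor {X : Type*} [Fintype X] (f : X → ℂ) {g : Y → ℂ} (hg : l2 g = 1)
    (P : X → Prop) [DecidablePred P] :
    ∑ p ∈ Finset.univ.filter (fun p : X × Y => P p.1), ‖f p.1 * g p.2‖ ^ 2 =
      ∑ x ∈ Finset.univ.filter P, ‖f x‖ ^ 2 := by
  rw [Finset.sum_filter, Finset.sum_filter, Fintype.sum_prod_type]
  refine Finset.sum_congr rfl fun x _ => ?_
  split_ifs with hx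
  · simp_rw [norm_mul, mul_pow]
    rw [← Finset.mul_sum, sum_normSq_eq_one hg, mul_one]
  · simp

/-- **Regev 2009, Lemma 3.14, ideal form, with an auxiliary register.** As `lemma_3_14_ideal`, but the
prepared state `ψ` lives on the register `s` together with any further (work, garbage, ancilla)
register `Y`, is within `η` of `ϑ̂₁ ⊗ g` for some unit `g`, the QFT acts as `F ⊗ I`, and only `t` is
read out: `|∑_{(t,y) : dec t ∈ A} |((F ⊗ I)ψ)(t,y)|² − D_{L,1/√2}(A)| ≤ 2η + 9·2⁻ⁿ`.
[cite: Regev2009, Lemma 3.14] -/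
theorem lemma_3_14_ideal_aux [DecidableEq Y] [Nontrivial V] (hsv : ShortVectorsTrivial Λ e R) {dec : (ι → ZMod R) → V}
    (hdec : IsDecoder Λ e R dec) {g : Y → ℂ} (hg : l2 g = 1) {ψ : (ι → ZMod R) × Y → ℂ} (hψ : l2 ψ = 1) {η : ℝ}
    (hη : l2 (ψ - fun p => normalize (thetaOne Λ e R) p.1 * g p.2) ≤ η) (A : Set V) :
    |∑ p ∈ Finset.univ.filter (fun p : (ι → ZMod R) × Y => dec p.1 ∈ A),
          ‖((QFTZMod.qftMatrix ι R ⊗ₖ (1 : Matrix Y Y ℂ)) *ᵥ ψ) p‖ ^ 2 -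
        ((discreteGaussian (primalLattice Λ e R) (Real.sqrt 2)⁻¹ 0).toOuterMeasure
          {x : primalLattice Λ e R | (x : V) ∈ A}).toReal| ≤
      2 * η + 9 * (2⁻¹ : ℝ) ^ finrank ℝ V := by
  set F := QFTZMod.qftMatrix ι R with hFdef
  have hU : F ∈ Matrix.unitaryGroup (ι → ZMod R) ℂ := QFTZMod.qftMatrix_mem_unitaryGroup (ι := ι) R
  have hU2 := kronecker_one_mem_unitaryGroup (Y := Y) hU
  obtain ⟨hθunit, hlaw⟩ := ideal_law_bound Λ e R hsv hdec A
  set θ := normalize (thetaOne' Λ e R) with hθ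
  have hΨunit : l2 ((F ⊗ₖ (1 : Matrix Y Y ℂ)) *ᵥ ψ) = 1 := by rw [l2_unitary_mulVec hU2, hψ]
  have hΘunit : l2 (fun p : (ι → ZMod R) × Y => θ p.1 * g p.2) = 1 := by rw [l2_tensor, hθunit, hg, one_mul]
  -- distance after `F ⊗ I`
  have hstep1 : l2 ((F ⊗ₖ (1 : Matrix Y Y ℂ)) *ᵥ ψ -
      (F ⊗ₖ (1 : Matrix Y Y ℂ)) *ᵥ fun p => normalize (thetaOne Λ e R) p.1 * g p.2) ≤ η := by
    rw [← Matrix.mulVec_sub, l2_unitary_mulVec hU2]; exact hη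
  have hstep2 : l2 (((F ⊗ₖ (1 : Matrix Y Y ℂ)) *ᵥ fun p => normalize (thetaOne Λ e R) p.1 * g p.2) -
      fun p => θ p.1 * g p.2) ≤ 4 * (2⁻¹ : ℝ) ^ finrank ℝ V := by
    rw [kronecker_one_mulVec_tensor,
      show ((fun p : (ι → ZMod R) × Y => (F *ᵥ normalize (thetaOne Λ e R)) p.1 * g p.2) - fun p => θ p.1 * g p.2) =
        fun p : (ι → ZMod R) × Y => (F *ᵥ normalize (thetaOne Λ e R) - θ) p.1 * g p.2 from
        funext fun p => by simp only [Pi.sub_apply, sub_mul],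
      l2_tensor, hg, mul_one]
    exact l2_qft_normalize_thetaOne_sub_le Λ e R
  have hdist : l2 ((F ⊗ₖ (1 : Matrix Y Y ℂ)) *ᵥ ψ - fun p => θ p.1 * g p.2) ≤ η + 4 * (2⁻¹ : ℝ) ^ finrank ℝ V :=
    (l2_sub_le _ _ _).trans (add_le_add hstep1 hstep2)
  have hmeas := abs_sum_filter_normSq_sub_le hΨunit hΘunit (fun p : (ι → ZMod R) × Y => dec p.1 ∈ A)
  rw [sum_filter_normSq_tensor θ hg (fun t => dec t ∈ A)] at hmeas
  have hfin := abs_sub_le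
    (∑ p ∈ Finset.univ.filter (fun p : (ι → ZMod R) × Y => dec p.1 ∈ A), ‖((F ⊗ₖ (1 : Matrix Y Y ℂ)) *ᵥ ψ) p‖ ^ 2)
    (∑ t ∈ Finset.univ.filter (fun t => dec t ∈ A), ‖θ t‖ ^ 2)
    ((discreteGaussian (primalLattice Λ e R) (Real.sqrt 2)⁻¹ 0).toOuterMeasure
          {x : primalLattice Λ e R | (x : V) ∈ A}).toReal
  linarith

end Aux

end Main

/-! ### The same statement from a `ℤ`-basis of `L` (Regev's data: `L`, its basis, and `R`) -/

section FromPrimal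

open Classical

variable (L : Submodule ℤ V) [DiscreteTopology L] [IsZLattice ℝ L] (b : Basis ι ℤ L)

omit [MeasurableSpace V] [BorelSpace V]

/-- **The basis `eᵢ = L*ᵢ/R` of `Λ = L*/R`** built from a `ℤ`-basis `(Lᵢ)` of `L` (`L*ᵢ` the dual
basis). [cite: Regev2009, Lemma 3.14 ("L*/R")] -/
def dualOverBasis : Basis ι ℝ V :=
  (LinearMap.BilinForm.dualBasis (innerₗ V : LinearMap.BilinForm ℝ V) innerₗ_nondegenerate
    (b.ofZLatticeBasis ℝ L)).unitsSMul fun _ => Units.mk0 ((R : ℝ)⁻¹) (inv_ne_zero (by exact_mod_cast NeZero.ne R))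

/-- `eᵢ = R⁻¹ L*ᵢ`. [folklore] -/
theorem dualOverBasis_apply (j : ι) :
    dualOverBasis (ι := ι) R L b j = (R : ℝ)⁻¹ •
      LinearMap.BilinForm.dualBasis (innerₗ V : LinearMap.BilinForm ℝ V) innerₗ_nondegenerate (b.ofZLatticeBasis ℝ L) j := by
  rw [dualOverBasis, Basis.unitsSMul_apply]
  rfl

/-- **`Λ = L*/R`** as a full-rank lattice. [cite: Regev2009, Lemma 3.14] -/
abbrev dualOver : Submodule ℤ V := Submodule.span ℤ (Set.range (dualOverBasis (ι := ι) R L b))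

/-- Its `ℤ`-basis `(eᵢ)`. [folklore] -/
def dualOverZBasis : Basis ι ℤ (dualOver (ι := ι) R L b) := (dualOverBasis (ι := ι) R L b).restrictScalars ℤ

/-- **`e*ⱼ = R Lⱼ`**: the dual basis of `(L*ᵢ/R)` is `(R Lⱼ)`. [cite: Regev2009, Lemma 3.14 ("(L*/R)* = RL")] -/
theorem dualVec_dualOver (j : ι) :
    dualVec (dualOver (ι := ι) R L b) (dualOverZBasis (ι := ι) R L b) j = (R : ℝ) • ((b j : L) : V) := by
  have hR : (R : ℝ) ≠ 0 := by exact_mod_cast NeZero.ne R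
  have hbasis : (dualOverZBasis (ι := ι) R L b).ofZLatticeBasis ℝ (dualOver (ι := ι) R L b) = dualOverBasis (ι := ι) R L b :=
    Basis.eq_of_apply_eq fun i => by
      rw [Basis.ofZLatticeBasis_apply]; exact Basis.restrictScalars_apply ℤ _ i
  unfold dualVec
  rw [hbasis]
  have key : (LinearMap.BilinForm.dualBasis (innerₗ V : LinearMap.BilinForm ℝ V) innerₗ_nondegenerate
      (dualOverBasis (ι := ι) R L b) : ι → V) = fun j => (R : ℝ) • ((b j : L) : V) := by
    rw [LinearMap.BilinForm.dualBasis_eq_iff]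
    intro i k
    have h := LinearMap.BilinForm.apply_dualBasis_left (B := (innerₗ V : LinearMap.BilinForm ℝ V)) innerₗ_nondegenerate
      (b.ofZLatticeBasis ℝ L) k i
    rw [innerₗ_apply_apply, Basis.ofZLatticeBasis_apply] at h
    rw [innerₗ_apply_apply, dualOverBasis_apply, real_inner_smul_left, real_inner_smul_right, real_inner_comm, h]
    by_cases hik : i = k
    · subst hik
      simp only [if_true]
      field_simp
    · rw [if_neg hik, if_neg (Ne.symm hik)]
      ring
  exact congrFun key j

/-- **`Lⱼ = e*ⱼ/R` recovers the given basis of `L`.** [folklore] -/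
theorem primalBasis_dualOver (j : ι) :
    primalBasis (dualOver (ι := ι) R L b) (dualOverZBasis (ι := ι) R L b) R j = ((b j : L) : V) := by
  have hR : (R : ℝ) ≠ 0 := by exact_mod_cast NeZero.ne R
  rw [primalBasis_apply, dualVec_dualOver, smul_smul, inv_mul_cancel₀ hR, one_smul]

/-- **`primalLattice (L*/R) = L`.** [cite: Regev2009, Lemma 3.14 ("(L*/R)* = RL")] -/
theorem primalLattice_dualOver :
    primalLattice (dualOver (ι := ι) R L b) (dualOverZBasis (ι := ι) R L b) R = L := by
  have hfun : (primalBasis (dualOver (ι := ι) R L b) (dualOverZBasis (ι := ι) R L b) R : ι → V) = b.ofZLatticeBasis ℝ L := by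
    funext j
    rw [primalBasis_dualOver, Basis.ofZLatticeBasis_apply]
  change Submodule.span ℤ (Set.range (primalBasis (dualOver (ι := ι) R L b) (dualOverZBasis (ι := ι) R L b) R)) = L
  rw [hfun, Basis.ofZLatticeBasis_span]

/-- `RL = (L*/R)*`. [cite: Regev2009, Lemma 3.14] -/
theorem scaledLattice_eq_dualLattice_dualOver : scaledLattice L R = dualLattice (dualOver (ι := ι) R L b) := by
  rw [← scaledLattice_primalLattice (dualOver (ι := ι) R L b) (dualOverZBasis (ι := ι) R L b) R, primalLattice_dualOver]

/-- **The representative `u_t = ∑ⱼ tⱼ Lⱼ`** ("`L t`"). [cite: Regev2009, Lemma 3.14] -/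
theorem reprPt_dualOver (t : ι → ZMod R) :
    reprPt (primalLattice (dualOver (ι := ι) R L b) (dualOverZBasis (ι := ι) R L b) R)
        (primalZBasis (dualOver (ι := ι) R L b) (dualOverZBasis (ι := ι) R L b) R) R t =
      ∑ j, ((t j).val : ℝ) • ((b j : L) : V) := by
  have hR : (R : ℝ) ≠ 0 := by exact_mod_cast NeZero.ne R
  rw [reprPt_primal_eq_dualPt, dualPt]
  refine Finset.sum_congr rfl fun j _ => ?_
  rw [dualVec_dualOver, smul_smul, div_mul_cancel₀ _ hR]

omit [NeZero R] in
/-- **Regev's printed hypothesis `R ≥ 2^{3n} λₙ(L*)` gives `λ₁(RL) > 2√n`** in the form consumed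
below: `x ∈ L`, `‖Rx‖ < 2√n ⇒ x = 0` (lower transference bound `λₙ(L*)λ₁(L) ≥ 1`, `L** = L`).
[cite: Regev2009, Lemma 3.14 (proof: "By using the easy part of Lemma 2.3, λ₁(RL) ≥ R/λₙ(L*) ≥ 2^{3n} > √n")] -/
theorem eq_zero_of_norm_smul_lt [Nontrivial V]
    (hR : (2 : ℝ) ^ (3 * finrank ℝ V) * successiveMinimum (dualLattice L) (finrank ℝ V) ≤ R)
    {x : V} (hx : x ∈ L) (hxn : ‖(R : ℝ) • x‖ < 2 * Real.sqrt (finrank ℝ V)) : x = 0 := by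
  by_contra hx0
  set n := finrank ℝ V with hn
  have hn1 : 1 ≤ n := Module.finrank_pos
  have hnR : (1 : ℝ) ≤ n := by exact_mod_cast hn1
  have hR0 : (0 : ℝ) ≤ R := Nat.cast_nonneg R
  -- `1 ≤ λₙ(L*) λ₁(L**) = λₙ(L*) λ₁(L) ≤ λₙ(L*) ‖x‖`
  have ht := one_le_successiveMinimum_mul_dual_holds (dualLattice L) (i := n) hn1 le_rfl
  rw [show n + 1 - n = 1 by omega, dualLattice_dualLattice, successiveMinimum_one_eq_minNorm_holds L] at ht
  have hmin : minNorm L ≤ ‖x‖ := minNorm_le_norm_of_mem_of_ne_zero L hx hx0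
  have hl0 : 0 ≤ successiveMinimum (dualLattice L) n := successiveMinimum_nonneg _ n
  have h1 : 1 ≤ successiveMinimum (dualLattice L) n * ‖x‖ := ht.trans (mul_le_mul_of_nonneg_left hmin hl0)
  -- hence `2^{3n} ≤ R ‖x‖ = ‖Rx‖ < 2√n ≤ 2^{3n}`
  have h2 : (2 : ℝ) ^ (3 * n) ≤ ‖(R : ℝ) • x‖ := by
    rw [norm_smul, Real.norm_eq_abs, abs_of_nonneg hR0]
    calc (2 : ℝ) ^ (3 * n) = 2 ^ (3 * n) * 1 := by ring
      _ ≤ 2 ^ (3 * n) * (successiveMinimum (dualLattice L) n * ‖x‖) := mul_le_mul_of_nonneg_left h1 (by positivity)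
      _ = (2 ^ (3 * n) * successiveMinimum (dualLattice L) n) * ‖x‖ := by ring
      _ ≤ R * ‖x‖ := mul_le_mul_of_nonneg_right hR (norm_nonneg _)
  have hsn : Real.sqrt n ≤ n := by
    rw [Real.sqrt_le_left (by positivity)]
    nlinarith
  have h2n : (n : ℝ) ≤ 2 ^ n := by exact_mod_cast (Nat.lt_two_pow_self).le
  have h8 : (2 : ℝ) * Real.sqrt n ≤ 2 ^ (3 * n) := by
    calc (2 : ℝ) * Real.sqrt n ≤ 2 * 2 ^ n := by nlinarith
      _ = 2 ^ (n + 1) := by ring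
      _ ≤ 2 ^ (3 * n) := pow_le_pow_right₀ one_le_two (by omega)
  linarith

variable [MeasurableSpace V] [BorelSpace V]

/-- **Regev 2009, Lemma 3.14, ideal form, from the data `(L, (Lⱼ), R)`.** For a full-rank lattice
`L` with `ℤ`-basis `(Lⱼ)`, a modulus `R` with `λ₁(RL) > 2√n` (stated as: `x ∈ L`, `‖Rx‖ < 2√n ⇒ x = 0`;
Regev: `R ≥ 2^{3n}λₙ(L*)`), a decoder `dec` returning `∑ tⱼLⱼ + Rx` whenever that point has norm
`< √n`, and any unit vector `ψ` within `η` of the normalised truncated periodic Gaussian state `ϑ̂₁`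
of `L*` over `L*/R` (in the coordinates of `L*ⱼ/R`): for every event `A ⊆ V`,
`|Pr_{t ∼ |Fψ|²}[dec t ∈ A] − D_{L,1/√2}(A)| ≤ 2η + 9·2⁻ⁿ`. [cite: Regev2009, Lemma 3.14] -/
theorem lemma_3_14_ideal_of_basis [Nontrivial V]
    (hL : ∀ x ∈ L, ‖(R : ℝ) • x‖ < 2 * Real.sqrt (finrank ℝ V) → x = 0)
    {dec : (ι → ZMod R) → V}
    (hdec : ∀ t : ι → ZMod R, ∀ x ∈ L,
      ‖∑ j, ((t j).val : ℝ) • ((b j : L) : V) + (R : ℝ) • x‖ < Real.sqrt (finrank ℝ V) →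
        dec t = ∑ j, ((t j).val : ℝ) • ((b j : L) : V) + (R : ℝ) • x)
    {ψ : (ι → ZMod R) → ℂ} (hψ : l2 ψ = 1) {η : ℝ}
    (hη : l2 (ψ - normalize (thetaOne (dualOver (ι := ι) R L b) (dualOverZBasis (ι := ι) R L b) R)) ≤ η) (A : Set V) :
    |∑ t ∈ Finset.univ.filter (fun t => dec t ∈ A), ‖(QFTZMod.qftMatrix ι R *ᵥ ψ) t‖ ^ 2 -
        ((discreteGaussian L (Real.sqrt 2)⁻¹ 0).toOuterMeasure {x : L | (x : V) ∈ A}).toReal| ≤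
      2 * η + 9 * (2⁻¹ : ℝ) ^ finrank ℝ V := by
  have hsv : ShortVectorsTrivial (dualOver (ι := ι) R L b) (dualOverZBasis (ι := ι) R L b) R := by
    intro z hz hzn
    rw [primalLattice_dualOver] at hz
    obtain ⟨x, hx, rfl⟩ := (mem_scaledLattice L).1 hz
    rw [hL x hx hzn, smul_zero]
  have hdec' : IsDecoder (dualOver (ι := ι) R L b) (dualOverZBasis (ι := ι) R L b) R dec := by
    intro t z hz hlt
    rw [reprPt_dualOver] at hlt ⊢
    rw [primalLattice_dualOver] at hz
    obtain ⟨x, hx, rfl⟩ := (mem_scaledLattice L).1 hz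
    exact hdec t x hx hlt
  have h := lemma_3_14_ideal (dualOver (ι := ι) R L b) (dualOverZBasis (ι := ι) R L b) R hsv hdec' hψ hη A
  have hs : (0 : ℝ) < (Real.sqrt 2)⁻¹ := inv_pos.2 (Real.sqrt_pos.2 two_pos)
  rw [toReal_toOuterMeasure_discreteGaussian_eq _ hs] at h
  rw [toReal_toOuterMeasure_discreteGaussian_eq _ hs]
  have hset : ((primalLattice (dualOver (ι := ι) R L b) (dualOverZBasis (ι := ι) R L b) R : Submodule ℤ V) : Set V) =
      (L : Set V) := by
    rw [primalLattice_dualOver]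
  rwa [hset] at h

end FromPrimal

/-! ### Scaling (general `CVP_{L*,d}` parameter: apply the above to `(d/√n)·L`) -/

section Scaling

open scoped Pointwise

omit [MeasurableSpace V] [BorelSpace V] [FiniteDimensional ℝ V]

/-- **Gaussian masses scale**: `ρ_{a s}(a S) = ρ_s(S)` for `a ≠ 0`; so `D_{aL, a s}(aA) = D_{L,s}(A)`,
which turns the normalised case `d = √n` (output `D_{L,1/√2}`) of Lemma 3.14 into the general one
(lattice `(d/√n)L`, output `D_{L, √n/(√2 d)}`): "by scaling". [cite: Regev2009, Lemma 3.14 (statement for general d); MicciancioRegev2007, §2] -/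
theorem gaussianMass_smul_set {a : ℝ} (ha : a ≠ 0) (s : ℝ) (S : Set V) :
    gaussianMass (a * s) 0 (a • S) = gaussianMass s 0 S := by
  unfold gaussianMass
  have hinj : Function.Injective fun x : V => a • x := smul_right_injective V ha
  rw [← Set.image_smul, ← (Equiv.Set.image (fun x : V => a • x) S hinj).tsum_eq]
  refine tsum_congr fun x => ?_
  simp only [Equiv.Set.image_apply, sub_zero]
  rw [gaussianFunction_smul s ha]

/-- The event dictionary under scaling: `(aL) ∩ (aA) = a(L ∩ A)`. [folklore] -/
theorem smul_inter {a : ℝ} (ha : a ≠ 0) (S A : Set V) : (a • S) ∩ (a • A) = a • (S ∩ A) :=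
  (Set.smul_set_inter₀ ha).symm

/-- **`D_{aL, as}(aA) = D_{L,s}(A)`** as ratios of Gaussian masses. [cite: MicciancioRegev2007, §2] -/
theorem gaussianMass_ratio_smul {a : ℝ} (ha : a ≠ 0) (s : ℝ) (S A : Set V) :
    (gaussianMass (a * s) 0 ((a • S) ∩ (a • A))).toReal / (gaussianMass (a * s) 0 (a • S)).toReal =
      (gaussianMass s 0 (S ∩ A)).toReal / (gaussianMass s 0 S).toReal := by
  rw [smul_inter ha, gaussianMass_smul_set ha, gaussianMass_smul_set ha]

end Scaling



end Regev2009

end Literature.Algebra.EuclideanLattices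

end
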